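import Mathlib
import Summits.ValiantsHypothesis.ValiantsHypothesis.Theorems.NewtonUnitEquationsDissociatedUniformGreedyCharts

/-!
# Crux `NewtonUnitEquations.DissociatedUniform` (stmt-ValiantsHypothesis-5905), line `greedy-basis-shadow` —
# stub `stub_coloredNovelty` (the COLORED NOVELTY LEMMA)

Setting: a finite family `Dm` of vectors `v d ∈ ℂ^k` with real weights `w` (injective on `Dm`) and colors
`col d ∈ κ`; the colors are embedded into `ℂ` by an injective `α : κ → ℂ`.  Call `d ∈ Dm` an `s`-POOL element if
there is a set `J` of at most `s` colors, not containing its own color, such that `v d` is not in the span of the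
LIGHTER (`w d' < w d`) elements of `Dm` whose color survives the deletion of `J`.

* `stub_coloredNovelty` (the registered stub): there are at most `(s + 1) · k` pool elements.

Proof (Vandermonde lift).  Put `L d (u, i) := α (col d) ^ u * v d i` for `u ≤ s`, a vector of
`ℂ^((s+1)·k)` (coordinates read through `finProdFinEquiv`).  If `d` is a pool element with witness `J`, then `L d`
is not in the span of the lifts of ALL lighter elements (`ColoredNovelty.lift_not_mem_span`): contracting a
dependence against the coefficient vector `p` of `P := ∏_{c ∈ J} (X − α c)` (degree `≤ s`,
`ColoredNovelty.exists_killer`) by the linear map `x ↦ (i ↦ ∑ u, p u * x (u, i))` turns `L d'` into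
`P(α (col d')) • v d'`, which vanishes when `col d' ∈ J` and is a multiple of a surviving lighter vector otherwise,
while `P(α (col d)) ≠ 0` (`α` injective, `col d ∉ J`); so `v d` would be spanned by surviving lighter vectors.
Hence the pool set sits inside the lex-greedy set of the lifted configuration for the height `-w`, which has at
most `(s+1)·k` elements by Theorem Q0 `ncard_lexGreedy_le_rank` (file
`NewtonUnitEquationsDissociatedUniformGreedyCharts.lean`).  No new definitions: the lift is a local `fun` of the
final proof, characterised by its coordinates (`hL`).  [folklore: polynomial method / Vandermonde lift]
-/

open scoped BigOperators
open Polynomial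

-- Sub = Summit single-conjunct layout: the duplicated namespace component is mandated by the tree.
set_option linter.dupNamespace false

namespace Summit.ValiantsHypothesis.ValiantsHypothesis.Theorems.NewtonUnitEquationsDissociatedUniform

namespace ColoredNovelty

variable {δ κ : Type} {k s : ℕ}

/-- The color-killing polynomial: for `|J| ≤ s` there is a coefficient vector `p : Fin (s+1) → ℂ` (that of
`∏_{c ∈ J} (X - C (α c))`) whose polynomial `∑ u, p u * z ^ u` vanishes at `z = α c` exactly when `c ∈ J`
(`α` injective). [folklore] -/
theorem exists_killer (α : κ → ℂ) (hα : Function.Injective α) (J : Finset κ) (hJ : J.card ≤ s) :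
    ∃ p : Fin (s + 1) → ℂ, ∀ c : κ, (∑ u : Fin (s + 1), p u * α c ^ (u : ℕ)) = 0 ↔ c ∈ J := by
  classical
  set P : ℂ[X] := ∏ c ∈ J, (X - C (α c)) with hP
  have hdeg : P.natDegree < s + 1 := by
    calc P.natDegree ≤ ∑ c ∈ J, (X - C (α c)).natDegree := natDegree_prod_le _ _
      _ = J.card := by simp
      _ < s + 1 := Nat.lt_succ_of_le hJ
  refine ⟨fun u => P.coeff u, fun c => ?_⟩
  have heval : (∑ u : Fin (s + 1), P.coeff u * α c ^ (u : ℕ)) = P.eval (α c) := by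
    rw [eval_eq_sum_range' hdeg, ← Fin.sum_univ_eq_sum_range (fun u => P.coeff u * α c ^ u)]
  rw [heval, hP, eval_prod]
  simp only [eval_sub, eval_X, eval_C]
  rw [Finset.prod_eq_zero_iff]
  constructor
  · rintro ⟨c', hc', h⟩
    rw [sub_eq_zero] at h
    rwa [hα h]
  · intro hc
    exact ⟨c, hc, sub_self _⟩

/-- **Key step (Vandermonde lift).**  Let `L : δ → ℂ^((s+1)·k)` have coordinates
`L d (u, i) = α (col d) ^ u * v d i` (through `finProdFinEquiv`).  If `d` is a pool element with witness `J`
(`|J| ≤ s`, `col d ∉ J`, `v d` not spanned by the lighter `J`-surviving vectors), then `L d` is not in the span of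
the lifts of ALL lighter elements. [folklore] -/
theorem lift_not_mem_span (Dm : Finset δ) (v : δ → Fin k → ℂ) (w : δ → ℝ) (col : δ → κ) (α : κ → ℂ)
    (hα : Function.Injective α) (L : δ → Fin ((s + 1) * k) → ℂ)
    (hL : ∀ (d : δ) (u : Fin (s + 1)) (i : Fin k), L d (finProdFinEquiv (u, i)) = α (col d) ^ (u : ℕ) * v d i)
    {d : δ} {J : Finset κ} (hJ : J.card ≤ s) (hcol : col d ∉ J)
    (hv : v d ∉ Submodule.span ℂ (v '' {d' : δ | d' ∈ Dm ∧ w d' < w d ∧ col d' ∉ J})) :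
    L d ∉ Submodule.span ℂ (L '' {d' : δ | d' ∈ Dm ∧ -w d < -w d'}) := by
  obtain ⟨p, hp⟩ := exists_killer (s := s) α hα J hJ
  intro hmem
  apply hv
  -- the contraction against `p`: `x ↦ (i ↦ ∑ u, p u * x (u, i))`
  let Φ : (Fin ((s + 1) * k) → ℂ) →ₗ[ℂ] (Fin k → ℂ) :=
    LinearMap.pi fun i => ∑ u : Fin (s + 1), p u • LinearMap.proj (finProdFinEquiv (u, i))
  have hΦ : ∀ d' : δ, Φ (L d') = (∑ u : Fin (s + 1), p u * α (col d') ^ (u : ℕ)) • v d' := by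
    intro d'
    funext i
    simp only [Φ, LinearMap.pi_apply, LinearMap.coe_sum, Finset.sum_apply, LinearMap.smul_apply,
      LinearMap.proj_apply, smul_eq_mul, Pi.smul_apply, hL]
    rw [Finset.sum_mul]
    refine Finset.sum_congr rfl fun u _ => ?_
    ring
  have h := Submodule.mem_map_of_mem (f := Φ) hmem
  rw [Submodule.map_span, hΦ] at h
  have hne : (∑ u : Fin (s + 1), p u * α (col d) ^ (u : ℕ)) ≠ 0 := fun h0 => hcol ((hp _).mp h0)
  have hle : Submodule.span ℂ (Φ '' (L '' {d' : δ | d' ∈ Dm ∧ -w d < -w d'})) ≤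
      Submodule.span ℂ (v '' {d' : δ | d' ∈ Dm ∧ w d' < w d ∧ col d' ∉ J}) := by
    refine Submodule.span_le.mpr ?_
    rintro _ ⟨_, ⟨d', ⟨hd'D, hlt⟩, rfl⟩, rfl⟩
    rw [hΦ]
    by_cases hc : col d' ∈ J
    · rw [(hp _).mpr hc, zero_smul]
      exact Submodule.zero_mem _
    · exact Submodule.smul_mem _ _ (Submodule.subset_span ⟨d', ⟨hd'D, by linarith, hc⟩, rfl⟩)
  have hvd : v d = (∑ u : Fin (s + 1), p u * α (col d) ^ (u : ℕ))⁻¹ •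
      ((∑ u : Fin (s + 1), p u * α (col d) ^ (u : ℕ)) • v d) := by
    rw [smul_smul, inv_mul_cancel₀ hne, one_smul]
  rw [hvd]
  exact Submodule.smul_mem _ _ (hle h)

end ColoredNovelty

/-- **Colored novelty lemma** (registered stub `stub_coloredNovelty` of line `greedy-basis-shadow`).  In a finite
colored vector configuration `v : Dm → ℂ^k` with weights `w` injective on `Dm`, the elements that become span-novel
with respect to the lighter elements after deleting at most `s` color classes other than their own number at most
`(s + 1) · k`.  (Vandermonde lift `L d (u, i) := α (col d) ^ u * v d i`, key step
`ColoredNovelty.lift_not_mem_span`, and Theorem Q0 `ncard_lexGreedy_le_rank` for the height `-w`.)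
[folklore: polynomial method] -/
theorem stub_coloredNovelty (δ κ : Type) (k s : ℕ) (Dm : Finset δ) (v : δ → Fin k → ℂ) (w : δ → ℝ)
    (col : δ → κ) (α : κ → ℂ) (hα : Function.Injective α) (hw : Set.InjOn w Dm) :
    {d : δ | d ∈ Dm ∧ ∃ J : Finset κ, J.card ≤ s ∧ col d ∉ J ∧
      v d ∉ Submodule.span ℂ (v '' {d' : δ | d' ∈ Dm ∧ w d' < w d ∧ col d' ∉ J})}.ncard ≤ (s + 1) * k := by
  -- the Vandermonde lift, read through `finProdFinEquiv : Fin (s+1) × Fin k ≃ Fin ((s+1) * k)`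
  set L : δ → Fin ((s + 1) * k) → ℂ :=
    fun d n => α (col d) ^ ((finProdFinEquiv.symm n).1 : ℕ) * v d (finProdFinEquiv.symm n).2 with hLdef
  have hL : ∀ (d : δ) (u : Fin (s + 1)) (i : Fin k), L d (finProdFinEquiv (u, i)) = α (col d) ^ (u : ℕ) * v d i :=
    fun d u i => by simp only [hLdef, Equiv.symm_apply_apply]
  have hinj : Set.InjOn (fun d => -w d) Dm := fun a ha b hb hab => hw ha hb (neg_injective hab)
  have hsub : {d : δ | d ∈ Dm ∧ ∃ J : Finset κ, J.card ≤ s ∧ col d ∉ J ∧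
      v d ∉ Submodule.span ℂ (v '' {d' : δ | d' ∈ Dm ∧ w d' < w d ∧ col d' ∉ J})} ⊆
      {d : δ | d ∈ Dm ∧ L d ∉ Submodule.span ℂ (L '' {d' : δ | d' ∈ Dm ∧ (fun d => -w d) d < (fun d => -w d) d'})} := by
    rintro d ⟨hdD, J, hJ, hcol, hv⟩
    exact ⟨hdD, ColoredNovelty.lift_not_mem_span Dm v w col α hα L hL hJ hcol hv⟩
  have hfin : {d : δ | d ∈ Dm ∧ L d ∉ Submodule.span ℂ
      (L '' {d' : δ | d' ∈ Dm ∧ (fun d => -w d) d < (fun d => -w d) d'})}.Finite :=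
    Dm.finite_toSet.subset fun d hd => hd.1
  exact (Set.ncard_le_ncard hsub hfin).trans (ncard_lexGreedy_le_rank δ ((s + 1) * k) Dm L (fun d => -w d) hinj)

end Summit.ValiantsHypothesis.ValiantsHypothesis.Theorems.NewtonUnitEquationsDissociatedUniform
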